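import Summits.BirchSwinnertonDyer.BirchSwinnertonDyer.Theses.MordellShaFreeCut
import Literature.NumberTheory.EllipticCurves.DasguptaVoight2018.SylvesterRankOne
import Literature.NumberTheory.EllipticCurves.CubeSumPrimeDescentInputs

set_option linter.dupNamespace false
set_option autoImplicit false

/-! # Route `MordellShaFreeCut` (rung S2b) — crux `RankPosOfThreeSelmerCorankOne`
(stmt-BirchSwinnertonDyer-19159, the route's declared RESIDUAL conjunct): a rung on the
Dasgupta–Voight SQUARE family `x³ + y³ = p²`, i.e. `D = −432 p⁴`, `p ≡ 4, 7 (mod 9)` prime,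
`3` not a cube mod `p`

The crux is the Ш-freeness half of the rank-one `3`-converse for the Mordell curves
`E_D : y² = x³ + D` at the RAMIFIED CM prime `3`:
`∀ D ≠ 0, corank_{ℤ₃} Sel_{3^∞}(E_D/ℚ) = 1 ⟹ rank E_D(ℚ) ≥ 1`
(`Summit.BirchSwinnertonDyer.BirchSwinnertonDyer.Theses.MordellShaFreeCut.RankPosOfThreeSelmerCorankOne`).

THE RUNG (plan g10 brief §6 (b) + addendum, 2026-08-26). Dasgupta–Voight, *Sylvester's problem
and mock Heegner points*, Proc. AMS 146 (2018) Thm. 2 — tree fact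
`Literature.NumberTheory.EllipticCurves.DasguptaVoight2018.thm2_mordellWeilRank_eq_one_cubeSum_prime_and_sq`
(REFEREED; mock Heegner points on `X₀(243) → E₉` over `K = ℚ(√−3)`, `3` RAMIFIED, non-torsion by
reduction mod the primes above `p`; no `L`-value anywhere in the proof) — gives, for every prime
`p ≡ 4, 7 (mod 9)` such that `3` is not a cube modulo `p`, `rank E_p(ℚ) = rank E_{p²}(ℚ) = 1`,
where `E_n : x³ + y³ = n` has the Weierstrass model `y² = x³ − 432 n²` (the tree's
`mordellCurve (−432 n²)`). The crux-A instance on the family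
  `F² := {D = −432 p⁴ : p prime, p ≡ 4, 7 (mod 9), 3 not a cube mod p}` (`E_{p²}`, e.g. `p = 7, 13,
  31, 43, 79, 97, …`)
is therefore PROVED from print, AT THE CRUX'S OWN PRIME `3` (additive for every `E_D`).

WHY THE SQUARE FAMILY AND NOT `D = −432 p²` (`E_p`). On the `E_p` half of the same theorem the
rung-leaf's conclusion `ord_{s=1} L(E_p, s) = 1` IS refereed print — Hu–Shu–Yin, Trans. AMS 372
(2019) Thm. 1.3 (1) with their explicit Gross–Zagier formula Thm. 1.5 for
`L′(E_p, 1)·L(E_{3p²}, 1)`; tree theorem `HuShuYin2019.rank_analyticRank_sha_dv_family` — so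
`E_p` is NOT separating (`rankPos_dvPrime` below records it, labelled). For `E_{p²}` no refereed
statement of `ord_{s=1} L(E_{p²}, s) = 1` exists on this family (HSY19: `E_p` only; DV18 §1.4 and
§5.3 Table 2 pair `E_{p²}` with `L(E_{3p}, 1)` heuristically; Yin, Trans. AMS 375 (2022): class
`p ≡ 8 (mod 9)`; Shu–Yin, Math. Ann. 385 (2023): classes `2, 5 (mod 9)`; Kezuka–Li 2020: `2p, 2p²`;
Yin's 2026 preprints arXiv:2605.25917 / 2607.01744 CLAIM it for all `p ≡ 4, 7 (mod 9)`,
unrefereed — memo `HOME/bsd-cn100-s2b-c3/SEPARATING-19159.md`). HONEST CAVEAT (same memo §3): that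
`L`-side is derivable — though printed nowhere — from DV's non-torsion case-2 mock Heegner point
and the general Gross–Zagier formula of Yuan–Zhang–Zhang (2013) through
`L(E₉/K, χ_{3p²}, s) = L(E_{p²}, s)·L(E_{3p}, s)`; the separation is at the level of PRINTED
theorems, which is what BC5 quantifies over, and the planner/tribunal decide whether it suffices.

WHAT IS PROVED HERE (modulo the ONE refereed named fact `hDV`; no new definition, no new fact):
* `rung_dvSquare` — crux A's statement VERBATIM restricted to `D = −432 p⁴ ∈ F²` (explicit binder
  `p`, the residue classes, the cubic-residue condition, then the crux's own hypothesis and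
  conclusion). HONESTY: the corank hypothesis is NOT USED by the proof (`rank = 1` holds on all of
  `F²`); what the proof gives for free towards non-vacuity is `corank_{ℤ₃} Sel_{3^∞}(E_{p²}) ≥ 1`
  (`one_le_selmerCorank_three_dvSquare`, Greenberg's identity `corank Sel = rank + corank Ш[3^∞]`);
  `= 1` would need `#Ш(E_{p²})[3^∞] < ∞`, not in print for this family (it would follow from the
  unprinted `L`-side above by Kolyvagin).
* `rankPos_dvSquare_of_crux` — the rung statement is a LITERAL RESTRICTION of crux A (pure logic).
* `rankPos_dvPrime` — crux A on the `E_p` half (`D = −432 p²`); NOT a separating witness (HSY19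
  Thm. 1.3 puts `ord L = 1` in print there); recorded only as the literal restriction.
* Instances `p = 7` (`49 = x³ + y³`, `D = −432·7⁴`; `7 ≡ 7 (mod 9)`, cubes mod `7` are `{0, ±1}`)
  and `p = 13` (`13 ≡ 4 (mod 9)`, cubes mod `13` are `{0, ±1, ±5}`), by `decide` on `ZMod 7`,
  `ZMod 13`.
The named forms for the tribunal's `--witness` / `--s-case` identifiers (`IsDVSquareFamily`,
`RankPosOnDVSquareFamily`, `AnalyticRankOneOnDVSquareFamily`) are filed separately in
`Theorems/MordellShaFreeCutDefs.lean` (definitions are reviewed; this proof file is definition-free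
so that it lands on the kernel). This file SUPPORTS item 19159 and does not close it; the crux stays
the route's declared residual (Kříž 2020 v5 Thm. 10.13 / Fan–Wan v2 Thm. 1.1, unrefereed). BSD is
not touched by any of this.
-/

namespace Summit.BirchSwinnertonDyer.BirchSwinnertonDyer.Theorems.MordellShaFreeCutRungDVSquare

open Literature.NumberTheory.EllipticCurves
open Literature.NumberTheory.EllipticCurves.DasguptaVoight2018
open Summit.BirchSwinnertonDyer.BirchSwinnertonDyer.Theses.MordellShaFreeCut
open WeierstrassCurve

/-- The parameter of the square family is non-zero: `−432 p⁴ ≠ 0` for a prime `p` (so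
`mordellCurve (−432 p⁴)` is an elliptic curve and the crux's guard `D ≠ 0` is automatic). -/
theorem dvSquare_param_ne_zero {p : ℕ} (hp : p.Prime) : (-(432 * ((p : ℚ) ^ 2) ^ 2) : ℚ) ≠ 0 := by
  have hp0 : (p : ℚ) ≠ 0 := by exact_mod_cast hp.ne_zero
  exact neg_ne_zero.mpr (mul_ne_zero (by norm_num) (pow_ne_zero 2 (pow_ne_zero 2 hp0)))

/-- The parameter of the prime family is non-zero: `−432 p² ≠ 0` for a prime `p`. -/
theorem dvPrime_param_ne_zero {p : ℕ} (hp : p.Prime) : (-(432 * (p : ℚ) ^ 2) : ℚ) ≠ 0 := by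
  have hp0 : (p : ℚ) ≠ 0 := by exact_mod_cast hp.ne_zero
  exact neg_ne_zero.mpr (mul_ne_zero (by norm_num) (pow_ne_zero 2 hp0))

/-- **`rank E_{p²}(ℚ) = 1` on the square family** (Dasgupta–Voight 2018 Thm. 2, second conjunct,
modulo the refereed fact `hDV`): for a prime `p ≡ 4, 7 (mod 9)` with `3` not a cube mod `p`, the
curve `y² = x³ − 432 p⁴` (= `x³ + y³ = p²`) has Mordell–Weil rank exactly `1` — mock Heegner points,
no `L`-value. -/
theorem mordellWeilRank_eq_one_dvSquare
    (hDV : thm2_mordellWeilRank_eq_one_cubeSum_prime_and_sq) {p : ℕ} (hp : p.Prime)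
    (h9 : p % 9 = 4 ∨ p % 9 = 7) (h3 : ¬ ∃ x : ZMod p, x ^ 3 = 3) :
    (mordellCurve (-(432 * ((p : ℚ) ^ 2) ^ 2))).mordellWeilRank = 1 :=
  (hDV hp h9 h3).2

/-- **Towards non-vacuity**: on the square family the crux's hypothesis is at least half-true —
`corank_{ℤ₃} Sel_{3^∞}(E_{p²}/ℚ) ≥ 1` (Greenberg's identity `corank Sel_{3^∞} = rank + corank Ш[3^∞]`,
tree theorem `selmerCorank_eq_mordellWeilRank_add_holds`, with `rank = 1` from `hDV`). Equality
would need `#Ш(E_{p²}/ℚ)[3^∞] < ∞`, which is not in print on this family. -/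
theorem one_le_selmerCorank_three_dvSquare
    (hDV : thm2_mordellWeilRank_eq_one_cubeSum_prime_and_sq) {p : ℕ} (hp : p.Prime)
    (h9 : p % 9 = 4 ∨ p % 9 = 7) (h3 : ¬ ∃ x : ZMod p, x ^ 3 = 3) :
    1 ≤ (mordellCurve (-(432 * ((p : ℚ) ^ 2) ^ 2))).selmerCorank 3 := by
  haveI := isElliptic_mordellCurve (dvSquare_param_ne_zero hp)
  haveI : Fact (Nat.Prime 3) := ⟨Nat.prime_three⟩
  have hadd := (mordellCurve (-(432 * ((p : ℚ) ^ 2) ^ 2))).selmerCorank_eq_mordellWeilRank_add_holds 3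
  have hr := mordellWeilRank_eq_one_dvSquare hDV hp h9 h3
  omega

/-- **RUNG for crux `RankPosOfThreeSelmerCorankOne` on the Dasgupta–Voight square family** — the
crux restricted to `D = −432 p⁴`: for every prime `p ≡ 4, 7 (mod 9)` such that `3` is not a cube
modulo `p`, if `corank_{ℤ₃} Sel_{3^∞}(E_{−432p⁴}/ℚ) = 1` then `rank E_{−432p⁴}(ℚ) ≥ 1` — PROVED at
the crux's own prime `3` from the refereed fact `hDV` (Dasgupta–Voight 2018, Thm. 2: `rank
E_{p²}(ℚ) = 1`), on a family where the rung-leaf's conclusion `ord_{s=1} L(E_{p²}, s) = 1` is in no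
refereed statement (memo SEPARATING-19159.md; caveat in the module docstring). The corank hypothesis
restricts the statement; the proof does not consume it. -/
theorem rung_dvSquare (hDV : thm2_mordellWeilRank_eq_one_cubeSum_prime_and_sq) :
    ∀ ⦃p : ℕ⦄, p.Prime → (p % 9 = 4 ∨ p % 9 = 7) → (¬ ∃ x : ZMod p, x ^ 3 = 3) →
      (mordellCurve (-(432 * ((p : ℚ) ^ 2) ^ 2))).selmerCorank 3 = 1 →
        1 ≤ (mordellCurve (-(432 * ((p : ℚ) ^ 2) ^ 2))).mordellWeilRank :=
  fun _ hp h9 h3 _ => (mordellWeilRank_eq_one_dvSquare hDV hp h9 h3).ge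

/-- The rung statement is a LITERAL RESTRICTION of crux A (so it is implied by the crux; pure
logic, the guard `D ≠ 0` being `dvSquare_param_ne_zero`). -/
theorem rankPos_dvSquare_of_crux (hA : RankPosOfThreeSelmerCorankOne) :
    ∀ ⦃p : ℕ⦄, p.Prime → (p % 9 = 4 ∨ p % 9 = 7) → (¬ ∃ x : ZMod p, x ^ 3 = 3) →
      (mordellCurve (-(432 * ((p : ℚ) ^ 2) ^ 2))).selmerCorank 3 = 1 →
        1 ≤ (mordellCurve (-(432 * ((p : ℚ) ^ 2) ^ 2))).mordellWeilRank :=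
  fun _ hp _ _ hc => hA (dvSquare_param_ne_zero hp) hc

/-- **Crux A on the `E_p` half `D = −432 p²`** (modulo `hDV`, first conjunct): the literal
restriction of `RankPosOfThreeSelmerCorankOne` to the Dasgupta–Voight PRIME family. NOT a separating
witness — there the leaf's conclusion `ord_{s=1} L(E_p, s) = 1` is refereed print (Hu–Shu–Yin 2019
Thm. 1.3 (1); tree `HuShuYin2019.rank_analyticRank_sha_dv_family`) — recorded for completeness only. -/
theorem rankPos_dvPrime (hDV : thm2_mordellWeilRank_eq_one_cubeSum_prime_and_sq) :
    ∀ ⦃p : ℕ⦄, p.Prime → (p % 9 = 4 ∨ p % 9 = 7) → (¬ ∃ x : ZMod p, x ^ 3 = 3) →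
      (mordellCurve (-(432 * (p : ℚ) ^ 2))).selmerCorank 3 = 1 →
        1 ≤ (mordellCurve (-(432 * (p : ℚ) ^ 2))).mordellWeilRank :=
  fun _ hp h9 h3 _ => (hDV hp h9 h3).1.ge

/-- `3` is not a cube modulo `7` (the cubes in `𝔽₇` are `0, 1, 6`). -/
theorem not_exists_cube_eq_three_mod_seven : ¬ ∃ x : ZMod 7, x ^ 3 = 3 := by decide

/-- `3` is not a cube modulo `13` (the cubes in `𝔽₁₃` are `0, 1, 5, 8, 12`). -/
theorem not_exists_cube_eq_three_mod_thirteen : ¬ ∃ x : ZMod 13, x ^ 3 = 3 := by decide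

/-- **`p = 7 ∈ F²`** (`7 ≡ 7 (mod 9)`, `3` not a cube mod `7`; `49 = x³ + y³`, `D = −432·7⁴`): the
rung's instance — `corank_{ℤ₃} Sel_{3^∞}(E_{−432·7⁴}) = 1 ⟹ rank ≥ 1`, modulo `hDV`. -/
theorem rung_seven (hDV : thm2_mordellWeilRank_eq_one_cubeSum_prime_and_sq)
    (hc : (mordellCurve (-(432 * (((7 : ℕ) : ℚ) ^ 2) ^ 2))).selmerCorank 3 = 1) :
    1 ≤ (mordellCurve (-(432 * (((7 : ℕ) : ℚ) ^ 2) ^ 2))).mordellWeilRank :=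
  rung_dvSquare hDV (by norm_num) (Or.inr rfl) not_exists_cube_eq_three_mod_seven hc

/-- **`p = 13 ∈ F²`** (`13 ≡ 4 (mod 9)`, `3` not a cube mod `13`; `169 = x³ + y³`, `D = −432·13⁴`):
the rung's instance at `p = 13`, modulo `hDV`. -/
theorem rung_thirteen (hDV : thm2_mordellWeilRank_eq_one_cubeSum_prime_and_sq)
    (hc : (mordellCurve (-(432 * (((13 : ℕ) : ℚ) ^ 2) ^ 2))).selmerCorank 3 = 1) :
    1 ≤ (mordellCurve (-(432 * (((13 : ℕ) : ℚ) ^ 2) ^ 2))).mordellWeilRank :=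
  rung_dvSquare hDV (by norm_num) (Or.inl rfl) not_exists_cube_eq_three_mod_thirteen hc

end Summit.BirchSwinnertonDyer.BirchSwinnertonDyer.Theorems.MordellShaFreeCutRungDVSquare

/-! ## Appendix (same seat, same session): the rung in the REGISTERED spelling `mordellCurve (−(432·p⁴))`
and the plan's kit names (plan g11, `HOME/bsd-cn100-plan/routes-g11/kit/`, 2026-08-26T05:04Z)

The planner registered the stub `stub_rung_dvSquare` on stmt-BirchSwinnertonDyer-19159 with the
coefficient spelled `-(432 * (p : ℚ) ^ 4)`; this file's `rung_dvSquare` spells it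
`-(432 * ((p : ℚ) ^ 2) ^ 2)` (= the Literature fact's `n = p²` reading of `−432 n²`). The two
Weierstrass curves are EQUAL (`mordellCurve_dvSquare_eq`, `ring`), so the rung is restated below in
the registered spelling (`rung_dvSquare_pow_four`) for the 3-line stub-credit alias
`stub_rung_dvSquare (hDV : DasguptaVoight2018.thm2_mordellWeilRank_eq_one_cubeSum_prime_and_sq)`
(to be filed in stub mode once the stub is re-registered WITH that binder — kit README registry
note; the kit's fact name `thm2_rank_eq_one_cubeSumCurve_prime_and_sq` does not exist, the tree fact
is `thm2_mordellWeilRank_eq_one_cubeSum_prime_and_sq`, p422669), and the kit's name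
`rung_cubeSumPrime_of_nonCube` is provided as a synonym of `rankPos_dvPrime`. -/

namespace Summit.BirchSwinnertonDyer.BirchSwinnertonDyer.Theorems.MordellShaFreeCutRungDVSquare

open Literature.NumberTheory.EllipticCurves
open Literature.NumberTheory.EllipticCurves.DasguptaVoight2018
open WeierstrassCurve

/-- The two spellings of the displayed model of `x³ + y³ = p²` agree: `−432 (p²)² = −432 p⁴`, so
`mordellCurve (−(432·(p²)²)) = mordellCurve (−(432·p⁴))` as Weierstrass curves. [folklore] -/
theorem mordellCurve_dvSquare_eq (p : ℕ) :
    mordellCurve (-(432 * ((p : ℚ) ^ 2) ^ 2)) = mordellCurve (-(432 * (p : ℚ) ^ 4)) := by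
  congr 1; ring

/-- **`rank E_{p²}(ℚ) = 1` in the registered spelling** `mordellCurve (−(432·p⁴))` (Dasgupta–Voight
2018 Thm. 2, second conjunct; modulo `hDV`). -/
theorem mordellWeilRank_eq_one_dvSquare_pow_four
    (hDV : thm2_mordellWeilRank_eq_one_cubeSum_prime_and_sq) {p : ℕ} (hp : p.Prime)
    (h9 : p % 9 = 4 ∨ p % 9 = 7) (h3 : ¬ ∃ x : ZMod p, x ^ 3 = 3) :
    (mordellCurve (-(432 * (p : ℚ) ^ 4))).mordellWeilRank = 1 := by
  rw [← mordellCurve_dvSquare_eq]; exact mordellWeilRank_eq_one_dvSquare hDV hp h9 h3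

/-- **The rung in the REGISTERED spelling** — exactly the signature of the stub `stub_rung_dvSquare`
registered on stmt-BirchSwinnertonDyer-19159 (plan g11, 2026-08-26T05:04Z), with the tree's DV fact
as its one named hypothesis: for every prime `p ≡ 4, 7 (mod 9)` with `3` not a cube mod `p`,
`corank_{ℤ₃} Sel_{3^∞}(E_{−432p⁴}/ℚ) = 1 ⟹ rank E_{−432p⁴}(ℚ) ≥ 1`. The stub-credit alias
`stub_rung_dvSquare` is this theorem under the registered name. -/
theorem rung_dvSquare_pow_four (hDV : thm2_mordellWeilRank_eq_one_cubeSum_prime_and_sq) :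
    ∀ ⦃p : ℕ⦄, p.Prime → (p % 9 = 4 ∨ p % 9 = 7) → (¬ ∃ x : ZMod p, x ^ 3 = 3) →
      (mordellCurve (-(432 * (p : ℚ) ^ 4))).selmerCorank 3 = 1 →
        1 ≤ (mordellCurve (-(432 * (p : ℚ) ^ 4))).mordellWeilRank :=
  fun _ hp h9 h3 _ => (mordellWeilRank_eq_one_dvSquare_pow_four hDV hp h9 h3).ge

/-- **Kit synonym** (plan g11 `routes-g11/kit/MordellShaFreeCutRungDVSquare.lean`): crux A's other
plan-only stub `stub_rung_cubeSumPrime` RESTRICTED to `3` a non-cube mod `p` — the `E_p` half of the DV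
fact (= `rankPos_dvPrime`; NOT separating, HSY19 Thm. 1.3; the unrestricted stub, all
`p ≡ 4, 7 (mod 9)`, is Elkies' announcement / Yin 2026's claim and stays open). -/
theorem rung_cubeSumPrime_of_nonCube (hDV : thm2_mordellWeilRank_eq_one_cubeSum_prime_and_sq) :
    ∀ ⦃p : ℕ⦄, p.Prime → (p % 9 = 4 ∨ p % 9 = 7) → (¬ ∃ x : ZMod p, x ^ 3 = 3) →
      (mordellCurve (-(432 * (p : ℚ) ^ 2))).selmerCorank 3 = 1 →
        1 ≤ (mordellCurve (-(432 * (p : ℚ) ^ 2))).mordellWeilRank :=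
  rankPos_dvPrime hDV

end Summit.BirchSwinnertonDyer.BirchSwinnertonDyer.Theorems.MordellShaFreeCutRungDVSquare

/-! ## Appendix 2 (same seat, same session): NON-VACUITY — on `F²` the crux's hypothesis HOLDS,
`corank_{ℤ₃} Sel_{3^∞}(E_{p²}/ℚ) = 1`, modulo the two refereed facts (Satgé 1986 Thm. 2.9 for
`D = p²`, tree fact `satge_selmerCorank_three_le_one_cubeSum_sq_of_prime_mod_nine`, p427454; and
Dasgupta–Voight 2018 Thm. 2)

`≥ 1` is `one_le_selmerCorank_three_dvSquare` (rank `= 1` + Greenberg); `≤ 1` is Satgé's `3`-descent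
read for the square (case (2) of Thm. 2.9 sees `D` only through `s = 0, a = 1, c = 0, D mod 9` — the
same instance as for `D = p`). Consequently `#Ш(E_{p²}/ℚ)[3^∞] < ∞` on `F²` (corank identity), all
without any `L`-value: the rung is non-vacuous exactly as the Monsky rung of S2
(`CongruentShaFreeCutRungMonsky.selmerCorank_two_eq_one_monskyUncovered`). -/

namespace Summit.BirchSwinnertonDyer.BirchSwinnertonDyer.Theorems.MordellShaFreeCutRungDVSquare

open Literature.NumberTheory.EllipticCurves
open Literature.NumberTheory.EllipticCurves.DasguptaVoight2018
open WeierstrassCurve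

/-- **Non-vacuity of the rung**: on `F²` the crux's HYPOTHESIS holds — for a prime `p ≡ 4, 7 (mod 9)`
with `3` not a cube mod `p`, `corank_{ℤ₃} Sel_{3^∞}(E_{p²}/ℚ) = 1` (`≤ 1`: Satgé 1986 Thm. 2.9 for
`D = p²`, `hS`; `≥ 1`: Dasgupta–Voight 2018 Thm. 2 + Greenberg's identity, `hDV`). No `L`-value used.
[cite: Satge1986, Thm. 2.9 (p. 312), case (2)] [cite: DasguptaVoight2018, Thm. 2] -/
theorem selmerCorank_three_eq_one_dvSquare
    (hS : satge_selmerCorank_three_le_one_cubeSum_sq_of_prime_mod_nine)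
    (hDV : thm2_mordellWeilRank_eq_one_cubeSum_prime_and_sq) {p : ℕ} (hp : p.Prime)
    (h9 : p % 9 = 4 ∨ p % 9 = 7) (h3 : ¬ ∃ x : ZMod p, x ^ 3 = 3) :
    (mordellCurve (-(432 * ((p : ℚ) ^ 2) ^ 2))).selmerCorank 3 = 1 :=
  le_antisymm (hS hp h9) (one_le_selmerCorank_three_dvSquare hDV hp h9 h3)

/-- Non-vacuity in the REGISTERED spelling `mordellCurve (−(432·p⁴))`. -/
theorem selmerCorank_three_eq_one_dvSquare_pow_four
    (hS : satge_selmerCorank_three_le_one_cubeSum_sq_of_prime_mod_nine)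
    (hDV : thm2_mordellWeilRank_eq_one_cubeSum_prime_and_sq) {p : ℕ} (hp : p.Prime)
    (h9 : p % 9 = 4 ∨ p % 9 = 7) (h3 : ¬ ∃ x : ZMod p, x ^ 3 = 3) :
    (mordellCurve (-(432 * (p : ℚ) ^ 4))).selmerCorank 3 = 1 := by
  rw [← mordellCurve_dvSquare_eq]; exact selmerCorank_three_eq_one_dvSquare hS hDV hp h9 h3

/-- **`#Ш(E_{p²}/ℚ)[3^∞] < ∞` on `F²`** (modulo `hS`, `hDV`): `corank Sel_{3^∞} = rank + corank Ш[3^∞]`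
(tree theorem `selmerCorank_eq_mordellWeilRank_add_holds`) with `1 = 1 + corank Ш[3^∞]`, and
`finite_primaryComponent_sha_iff_shaCorank_eq_zero`. So on `F²` BOTH hypotheses of crux B
(`rank = 1`, `#Ш[3^∞] < ∞`) hold in print, while its conclusion `ord_{s=1} L = 1` is in no refereed
statement (memo SEPARATING-19159.md): `F²` is a separating family for the attacked conjunct B as well.
[cite: Satge1986, Thm. 2.9 (p. 312), case (2)] [cite: DasguptaVoight2018, Thm. 2] -/
theorem finite_sha_three_dvSquare
    (hS : satge_selmerCorank_three_le_one_cubeSum_sq_of_prime_mod_nine)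
    (hDV : thm2_mordellWeilRank_eq_one_cubeSum_prime_and_sq) {p : ℕ} (hp : p.Prime)
    (h9 : p % 9 = 4 ∨ p % 9 = 7) (h3 : ¬ ∃ x : ZMod p, x ^ 3 = 3) :
    Finite (AddCommGroup.primaryComponent (mordellCurve (-(432 * ((p : ℚ) ^ 2) ^ 2))).sha 3) := by
  haveI := isElliptic_mordellCurve (dvSquare_param_ne_zero hp)
  haveI : Fact (Nat.Prime 3) := ⟨Nat.prime_three⟩
  have hadd :=
    (mordellCurve (-(432 * ((p : ℚ) ^ 2) ^ 2))).selmerCorank_eq_mordellWeilRank_add_holds 3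
  have hr := mordellWeilRank_eq_one_dvSquare hDV hp h9 h3
  have hc := selmerCorank_three_eq_one_dvSquare hS hDV hp h9 h3
  have hsha : (mordellCurve (-(432 * ((p : ℚ) ^ 2) ^ 2))).shaCorank 3 = 0 := by omega
  exact (finite_primaryComponent_sha_iff_shaCorank_eq_zero _ 3).2 hsha

/-- **On `F²` crux B's instance IS the leaf's instance** (modulo `hS`, `hDV`): granted
`AnalyticRankOneOfRankOneFiniteShaThree` (the route's ATTACKED conjunct), every member of `F²` has
`ord_{s=1} L(E_{p²}, s) = 1` — its two hypotheses hold there by `mordellWeilRank_eq_one_dvSquare` and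
`finite_sha_three_dvSquare`. (The residual A contributes nothing on `F²`.) -/
theorem analyticRank_eq_one_dvSquare_of_cruxB
    (hS : satge_selmerCorank_three_le_one_cubeSum_sq_of_prime_mod_nine)
    (hDV : thm2_mordellWeilRank_eq_one_cubeSum_prime_and_sq)
    (hB : Summit.BirchSwinnertonDyer.BirchSwinnertonDyer.Theses.MordellShaFreeCut.AnalyticRankOneOfRankOneFiniteShaThree)
    {p : ℕ} (hp : p.Prime) (h9 : p % 9 = 4 ∨ p % 9 = 7) (h3 : ¬ ∃ x : ZMod p, x ^ 3 = 3) :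
    (mordellCurve (-(432 * ((p : ℚ) ^ 2) ^ 2))).analyticRank = 1 :=
  hB (dvSquare_param_ne_zero hp) (mordellWeilRank_eq_one_dvSquare hDV hp h9 h3)
    (finite_sha_three_dvSquare hS hDV hp h9 h3)

end Summit.BirchSwinnertonDyer.BirchSwinnertonDyer.Theorems.MordellShaFreeCutRungDVSquare
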